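import Literature.Geometry.Lorentzian.AsymptoticFlatnessEnergy
import Literature.Geometry.Lorentzian.ConformalScalarFlat
import Literature.Geometry.Lorentzian.CurvatureRegularity
import HarnessLib

/-!
# Bounded truncated first moments of the scalar curvature on an asymptotically flat end

On an end with `h − δ = O₂(r⁻²)` in the chart (`IsMetricAsymptoticallyFlat e D 2`: the decay
of Schoen–Yau's (1.1) with mass parameter `M = 0`, as in the rigidity case of the positive mass
theorem), the scalar curvature read in the chart, `R(h)∘Φ = scalarCurvatureCoeff e D`, is only
`O(r⁻⁴)`, so that its first absolute moment `∫ |R(h)∘Φ| |y| dy` may diverge logarithmically.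
Nevertheless its *truncated first moments are bounded*:

* `AFEnd.exists_bound_setIntegral_scalarCurvatureCoeff_mul` — there are `C` and `R₂ > R` with
  `|∫_{a < ‖y‖ < c} R(h)(Φ y) yₖ dy| ≤ C` for all `R₂ ≤ a ≤ c`, `k = 1, 2, 3`;
* `AFEnd.exists_bound_norm_setIntegral_scalarCurvatureCoeff_smul` — the same for the vector
  `∫_{a < ‖y‖ < c} R(h)(Φ y) y dy`;
* `AFEnd.exists_bound_norm_setIntegral_ball_scalarCurvatureCoeff_smul` — the same over balls for
  the density `𝟙_{R₂ < ‖y‖} R(h)∘Φ`, which is literally the moment hypothesis of the far-field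
  expansion of Newtonian potentials
  (`Literature.Analysis.Potential.integral_inv_norm_sub_mul_sub_isBigO`, `NewtonFarField.lean`).

This is the structural fact behind the sharp `O(r⁻²)` remainder (no logarithm) in Schoen–Yau's
expansion `φ = 1 + A/r + ω`, `|ω| ≤ k (1 + r²)⁻¹`, of the conformal factor solving `Δφ = Rφ/8`
(Comm. Math. Phys. 65 (1979), Lemma 3.3 with Lemma 3.2, (3.17)–(3.18), applied to (3.23)): the
source `R/8` of the linear equation has bounded truncated moments although it is only `O(r⁻⁴)`.

## The proof

The `r⁻⁴` part of the scalar curvature is in divergence form. With the ADM flux field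
`Vᵢ = ∑ⱼ (∂ⱼhᵢⱼ − ∂ᵢhⱼⱼ) = O(r⁻³)` (Arnowitt–Deser–Misner; Bartnik 1986, (4.2)),

* `R(h)∘Φ = div V + Q` with `|Q| ≤ K r⁻⁶` (Bartnik 1986, (4.3)–(4.4);
  `AFEnd.exists_bound_scalarCurvatureCoeff_sub_trace` of `AsymptoticFlatnessEnergy.lean`), so
  `∫ |Q| |y| ≤ K ∫_{‖y‖>1} ‖y‖⁻⁵ < ∞`;
* `yₖ div V = div(yₖ V) − Vₖ` (`trace_fderiv_coord_smul`) and `Vₖ = div Tₖ` for the traceless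
  part of `h − δ`, `(Tₖ)ⱼ = (h − δ)ₖⱼ − δⱼₖ tr(h − δ) = O(r⁻²)` (`AFEnd.trace_fderiv_tracelessPart`,
  `AFEnd.norm_tracelessPart_le`);
* Gauss–Green on the shell `{a < ‖y‖ < c}` (`FluidPDE.setIntegral_shell_divergence_eq`, applied
  to `C¹` extensions of `yₖ V` and `Tₖ` across the inner ball, `AFEnd.exists_contDiff_one_extension`)
  turns `∫ yₖ div V` into four sphere integrals, `∮ yₖ ⟨ν, V⟩` and `∮ ⟨ν, Tₖ⟩` at `r = a, c`, each
  of size `r² · (r · 18‖Dh‖)` resp. `r² · 6‖h − δ‖`, i.e. `O(1)` by the decay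
  (`AFEnd.norm_admVec_le`).

All results are proved; nothing is defined and no named fact is introduced.

## References

* R. Schoen, S.-T. Yau, *On the proof of the positive mass conjecture in general relativity*,
  Comm. Math. Phys. 65 (1979) 45–76, Lemma 3.2 (3.17)–(3.18), Lemma 3.3 (3.23). [SchoenYauPMT1979]
* R. Bartnik, *The mass of an asymptotically flat manifold*, CPAM 39 (1986), §4, (4.2)–(4.4).
  [Bartnik1986]
* R. Arnowitt, S. Deser, C. W. Misner, *The dynamics of general relativity* (1962).
-/

noncomputable section

-- nested operator types `E3 →L[ℝ] E3 →L[ℝ] E3 →L[ℝ] ℝ` (components of `Dh`)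
set_option maxSynthPendingDepth 3

open Set Function Filter Metric MeasureTheory Bornology Asymptotics Module
open scoped Topology Manifold ContDiff RealInnerProductSpace

namespace Literature.Geometry.Lorentzian

/-! ### Divergence calculus on `E3` -/

section Calculus

variable {E : Type*} [NormedAddCommGroup E] [InnerProductSpace ℝ E] [FiniteDimensional ℝ E]

omit [FiniteDimensional ℝ E] in
/-- **Divergence of a frame expansion**: if `T y = ∑ⱼ cⱼ(y) bⱼ` in an orthonormal basis `b` with
scalar coefficients differentiable at `x`, then `tr DT(x) = ∑ⱼ Dcⱼ(x)(bⱼ)`. [folklore] -/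
theorem trace_fderiv_sum_smul {ι : Type*} [Fintype ι] [DecidableEq ι] (b : OrthonormalBasis ι ℝ E)
    {c : ι → E → ℝ} {T : E → E} (hT : ∀ y, T y = ∑ j, c j y • b j) {x : E}
    (hc : ∀ j, DifferentiableAt ℝ (c j) x) :
    LinearMap.trace ℝ E (fderiv ℝ T x : E →ₗ[ℝ] E) = ∑ j, fderiv ℝ (c j) x (b j) := by
  have hfun : T = fun y ↦ ∑ j, c j y • b j := funext hT
  subst hfun
  have hd : HasFDerivAt (fun y ↦ ∑ j, c j y • b j) (∑ j, (fderiv ℝ (c j) x).smulRight (b j)) x :=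
    HasFDerivAt.fun_sum fun j _ ↦ (hc j).hasFDerivAt.smul_const (b j)
  rw [hd.fderiv, LinearMap.trace_eq_sum_inner _ b]
  have horth : ∀ a i, ⟪b a, b i⟫ = if a = i then (1 : ℝ) else 0 := fun a i ↦
    orthonormal_iff_ite.1 b.orthonormal a i
  simp only [ContinuousLinearMap.coe_coe, _root_.sum_apply, ContinuousLinearMap.smulRight_apply,
    inner_sum, inner_smul_right, horth, mul_ite, mul_one, mul_zero, Finset.sum_ite_eq,
    Finset.mem_univ, if_true]

/-- **Divergence of a scalar multiple**: `tr D(φ W)(x) = φ(x) tr DW(x) + Dφ(x)(W x)`.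
[folklore] -/
theorem trace_fderiv_smul {φ : E → ℝ} {W : E → E} {x : E} (hφ : DifferentiableAt ℝ φ x)
    (hW : DifferentiableAt ℝ W x) :
    LinearMap.trace ℝ E (fderiv ℝ (fun y ↦ φ y • W y) x : E →ₗ[ℝ] E) =
      φ x * LinearMap.trace ℝ E (fderiv ℝ W x : E →ₗ[ℝ] E) + fderiv ℝ φ x (W x) := by
  have hd : HasFDerivAt (fun y ↦ φ y • W y)
      (φ x • fderiv ℝ W x + (fderiv ℝ φ x).smulRight (W x)) x :=
    hφ.hasFDerivAt.smul hW.hasFDerivAt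
  rw [hd.fderiv]
  obtain ⟨b⟩ : Nonempty (OrthonormalBasis (Fin (finrank ℝ E)) ℝ E) := ⟨stdOrthonormalBasis ℝ E⟩
  rw [LinearMap.trace_eq_sum_inner _ b, LinearMap.trace_eq_sum_inner _ b]
  simp only [ContinuousLinearMap.coe_coe, _root_.add_apply,
    _root_.smul_apply, ContinuousLinearMap.smulRight_apply, inner_add_right,
    inner_smul_right, Finset.sum_add_distrib, ← Finset.mul_sum]
  congr 1
  -- `∑ᵢ Dφ(bᵢ) ⟪bᵢ, W x⟫ = Dφ(W x)`
  calc ∑ i, fderiv ℝ φ x (b i) * ⟪b i, W x⟫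
      = fderiv ℝ φ x (∑ i, ⟪b i, W x⟫ • b i) := by
        rw [map_sum]
        refine Finset.sum_congr rfl fun i _ ↦ ?_
        rw [map_smul, smul_eq_mul, mul_comm]
    _ = fderiv ℝ φ x (W x) := by rw [b.sum_repr' (W x)]

/-- **Divergence of `y ↦ yₖ W(y)` on `ℝ³`**: `tr D(yₖ W)(x) = xₖ tr DW(x) + W(x)ₖ`. [folklore] -/
theorem trace_fderiv_coord_smul {W : E3 → E3} {x : E3} (hW : DifferentiableAt ℝ W x) (k : Fin 3) :
    LinearMap.trace ℝ E3 (fderiv ℝ (fun y : E3 ↦ y k • W y) x : E3 →ₗ[ℝ] E3) =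
      x k * LinearMap.trace ℝ E3 (fderiv ℝ W x : E3 →ₗ[ℝ] E3) + W x k := by
  have hφ : HasFDerivAt (fun y : E3 ↦ y k) (EuclideanSpace.proj k : E3 →L[ℝ] ℝ) x :=
    (EuclideanSpace.proj (𝕜 := ℝ) k).hasFDerivAt
  rw [trace_fderiv_smul hφ.differentiableAt hW, hφ.fderiv]
  rfl

end Calculus

/-- `‖x‖⁻¹ • x` has norm at most one. [folklore] -/
theorem norm_inv_norm_smul_le_one {E : Type*} [NormedAddCommGroup E] [NormedSpace ℝ E] (x : E) :
    ‖‖x‖⁻¹ • x‖ ≤ 1 := by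
  by_cases hx : x = 0
  · simp [hx]
  · rw [norm_smul, norm_inv, norm_norm, inv_mul_cancel₀ (norm_ne_zero_iff.2 hx)]

/-! ### The ADM field and the traceless part of `h - δ` on an end -/

namespace AFEnd

variable {X : Type} [TopologicalSpace X] [ChartedSpace E3 X] [IsManifold (𝓡 3) ∞ X]
  (e : AFEnd X) (D : InitialDataSet (𝓡 3) X)

omit [IsManifold (𝓡 3) ∞ X] in
/-- **A `C¹` extension across the inner ball**: a field which is `C¹` at every point of
`{R < ‖x‖}` agrees on `R + 2 ≤ ‖x‖` with a `C¹` field on all of `ℝ³` (multiply by the radial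
cut-off of `exists_smooth_radial_cutoff`). [folklore] -/
theorem exists_contDiff_one_extension {F : E3 → E3} (hF : ∀ x, e.R < ‖x‖ → ContDiffAt ℝ 1 F x) :
    ∃ W : E3 → E3, ContDiff ℝ 1 W ∧ ∀ x, e.R + 2 ≤ ‖x‖ → W x = F x := by
  obtain ⟨χ, hχ, hχ0, hχ1⟩ := exists_smooth_radial_cutoff e.R_pos.le
  refine ⟨fun x ↦ χ x • F x, contDiff_iff_contDiffAt.2 fun x ↦ ?_, fun x hx ↦ by
    simp only [hχ1 x hx, one_smul]⟩
  by_cases hx : e.R < ‖x‖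
  · exact (hχ.contDiffAt.of_le (WithTop.coe_le_coe.mpr le_top)).smul (hF x hx)
  · push Not at hx
    have hzero : (fun y ↦ χ y • F y) =ᶠ[𝓝 x] fun _ ↦ (0 : E3) := by
      have hball : ball (0 : E3) (e.R + 1) ∈ 𝓝 x :=
        isOpen_ball.mem_nhds (mem_ball_zero_iff.2 (by linarith))
      filter_upwards [hball] with y hy
      rw [hχ0 y (mem_ball_zero_iff.1 hy).le, zero_smul]
    exact contDiffAt_const.congr_of_eventuallyEq hzero

/-- The coordinate derivative `∂ₗ hᵢⱼ(x)` is a component of `Dh(x)` (for `R < ‖x‖`, where the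
`hᵢⱼ` are smooth). [folklore] -/
theorem partialH_eq_fderiv {x : E3} (hx : e.R < ‖x‖) (l i j : Fin 3) :
    partialH e D l i j x = fderiv ℝ (hCoeff e D) x (EuclideanSpace.basisFun (Fin 3) ℝ l)
      (EuclideanSpace.basisFun (Fin 3) ℝ i) (EuclideanSpace.basisFun (Fin 3) ℝ j) := by
  have hd : DifferentiableAt ℝ (hCoeff e D) x :=
    (e.contDiffAt_hCoeff D hx).differentiableAt (by simp)
  simp only [partialH, EuclideanSpace.basisFun_apply]
  exact OpensChart.fderiv_apply₂ (hCoeff e D) hd _ _ _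

/-- **Decay of the ADM field**: `‖V(x)‖ ≤ 18 ‖Dh(x)‖` for `R < ‖x‖` (eighteen components of
`Dh`). [folklore] -/
theorem norm_admVec_le (V : E3 → E3)
    (hV : ∀ x, V x = ∑ i, (∑ j, (partialH e D j i j x - partialH e D i j j x)) •
      EuclideanSpace.basisFun (Fin 3) ℝ i) {x : E3} (hx : e.R < ‖x‖) :
    ‖V x‖ ≤ 18 * ‖fderiv ℝ (hCoeff e D) x‖ := by
  set b := EuclideanSpace.basisFun (Fin 3) ℝ with hb
  have hb1 : ∀ i, ‖b i‖ = 1 := fun i ↦ b.orthonormal.1 i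
  set q := ‖fderiv ℝ (hCoeff e D) x‖ with hq
  have hP : ∀ l i j, |partialH e D l i j x| ≤ q := fun l i j ↦ by
    rw [e.partialH_eq_fderiv D hx]
    exact abs_fderiv_apply_le b x l i j
  rw [hV x]
  calc ‖∑ i, (∑ j, (partialH e D j i j x - partialH e D i j j x)) • b i‖
      ≤ ∑ i, ‖(∑ j, (partialH e D j i j x - partialH e D i j j x)) • b i‖ := norm_sum_le _ _
    _ ≤ ∑ _i : Fin 3, ∑ _j : Fin 3, (q + q) := by
        refine Finset.sum_le_sum fun i _ ↦ ?_
        rw [norm_smul, hb1, mul_one, Real.norm_eq_abs]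
        refine (Finset.abs_sum_le_sum_abs _ _).trans (Finset.sum_le_sum fun j _ ↦ ?_)
        exact (abs_sub _ _).trans (add_le_add (hP j i j) (hP i j j))
    _ = 18 * q := by simp; ring

/-- The `k`-th component of the ADM field: `⟨eₖ, V(x)⟩ = ∑ⱼ (∂ⱼhₖⱼ − ∂ₖhⱼⱼ)(x)`. [folklore] -/
theorem inner_admVec (V : E3 → E3)
    (hV : ∀ x, V x = ∑ i, (∑ j, (partialH e D j i j x - partialH e D i j j x)) •
      EuclideanSpace.basisFun (Fin 3) ℝ i) (x : E3) (k : Fin 3) :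
    ⟪EuclideanSpace.basisFun (Fin 3) ℝ k, V x⟫ =
      ∑ j, (partialH e D j k j x - partialH e D k j j x) := by
  set b := EuclideanSpace.basisFun (Fin 3) ℝ with hb
  have horth : ∀ i, ⟪b k, b i⟫ = if k = i then (1 : ℝ) else 0 := fun i ↦
    orthonormal_iff_ite.1 b.orthonormal k i
  rw [hV x, inner_sum]
  simp only [inner_smul_right, horth, mul_ite, mul_one, mul_zero, Finset.sum_ite_eq,
    Finset.mem_univ, if_true]

/-- **The traceless part of `h − δ` has divergence `Vₖ`.** For the field
`T y = ∑ⱼ ((h − δ)ₖⱼ − δⱼₖ tr(h − δ))(y) eⱼ` (given through the representative hypothesis `hT`)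
and `R < ‖x‖`: `tr DT(x) = ∑ⱼ (∂ⱼhₖⱼ − ∂ₖhⱼⱼ)(x) = ⟨eₖ, V(x)⟩`. [folklore] -/
theorem trace_fderiv_tracelessPart (k : Fin 3) (T : E3 → E3)
    (hT : ∀ y, T y = ∑ j, ((hCoeff e D y - (innerSL ℝ : E3 →L[ℝ] E3 →L[ℝ] ℝ))
        (EuclideanSpace.basisFun (Fin 3) ℝ k) (EuclideanSpace.basisFun (Fin 3) ℝ j) -
        (if j = k then ∑ l, (hCoeff e D y - (innerSL ℝ : E3 →L[ℝ] E3 →L[ℝ] ℝ))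
          (EuclideanSpace.basisFun (Fin 3) ℝ l) (EuclideanSpace.basisFun (Fin 3) ℝ l) else 0)) •
        EuclideanSpace.basisFun (Fin 3) ℝ j)
    {x : E3} (hx : e.R < ‖x‖) :
    LinearMap.trace ℝ E3 (fderiv ℝ T x : E3 →ₗ[ℝ] E3) =
      ∑ j, (partialH e D j k j x - partialH e D k j j x) := by
  set b := EuclideanSpace.basisFun (Fin 3) ℝ with hb
  set δ : E3 →L[ℝ] E3 →L[ℝ] ℝ := innerSL ℝ with hδ
  have hd : DifferentiableAt ℝ (hCoeff e D) x :=
    (e.contDiffAt_hCoeff D hx).differentiableAt (by simp)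
  -- the scalar components and their derivatives
  have hcomp : ∀ u v : E3, (fun y ↦ (hCoeff e D y - δ) u v) = fun y ↦ hCoeff e D y u v - δ u v := by
    intro u v; funext y; simp only [_root_.sub_apply]
  have hdc : ∀ u v : E3, DifferentiableAt ℝ (fun y ↦ (hCoeff e D y - δ) u v) x := by
    intro u v
    rw [hcomp]
    exact ((hd.clm_apply (differentiableAt_const u)).clm_apply (differentiableAt_const v)).sub_const _
  have hfd : ∀ u v w : E3, fderiv ℝ (fun y ↦ (hCoeff e D y - δ) u v) x w =
      fderiv ℝ (hCoeff e D) x w u v := by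
    intro u v w
    rw [hcomp, fderiv_sub_const, OpensChart.fderiv_apply₂ (hCoeff e D) hd]
  -- the coefficient functions
  set c : Fin 3 → E3 → ℝ := fun j y ↦ (hCoeff e D y - δ) (b k) (b j) -
    (if j = k then ∑ l, (hCoeff e D y - δ) (b l) (b l) else 0) with hc
  have hTc : ∀ y, T y = ∑ j, c j y • b j := fun y ↦ by rw [hT y]
  have hcd : ∀ j, DifferentiableAt ℝ (c j) x := by
    intro j
    simp only [hc]
    refine (hdc _ _).sub ?_
    split_ifs
    · exact DifferentiableAt.fun_sum fun l _ ↦ hdc _ _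
    · exact differentiableAt_const _
  rw [trace_fderiv_sum_smul b hTc hcd]
  -- compute `∂ⱼ cⱼ`
  have hdcj : ∀ j, fderiv ℝ (c j) x (b j) = fderiv ℝ (hCoeff e D) x (b j) (b k) (b j) -
      (if j = k then ∑ l, fderiv ℝ (hCoeff e D) x (b j) (b l) (b l) else 0) := by
    intro j
    simp only [hc]
    rw [fderiv_fun_sub (hdc _ _) (by
      split_ifs
      · exact DifferentiableAt.fun_sum fun l _ ↦ hdc _ _
      · exact differentiableAt_const _), _root_.sub_apply, hfd]
    congr 1
    split_ifs with hjk
    · rw [fderiv_fun_sum fun l _ ↦ hdc _ _]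
      simp only [_root_.sum_apply]
      exact Finset.sum_congr rfl fun l _ ↦ hfd _ _ _
    · simp
  simp_rw [hdcj, Finset.sum_sub_distrib, Finset.sum_ite_eq', Finset.mem_univ, if_true,
    e.partialH_eq_fderiv D hx]
  rfl

/-- **The traceless part of `h − δ` is bounded by `6‖h − δ‖`.** [folklore] -/
theorem norm_tracelessPart_le (k : Fin 3) (T : E3 → E3)
    (hT : ∀ y, T y = ∑ j, ((hCoeff e D y - (innerSL ℝ : E3 →L[ℝ] E3 →L[ℝ] ℝ))
        (EuclideanSpace.basisFun (Fin 3) ℝ k) (EuclideanSpace.basisFun (Fin 3) ℝ j) -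
        (if j = k then ∑ l, (hCoeff e D y - (innerSL ℝ : E3 →L[ℝ] E3 →L[ℝ] ℝ))
          (EuclideanSpace.basisFun (Fin 3) ℝ l) (EuclideanSpace.basisFun (Fin 3) ℝ l) else 0)) •
        EuclideanSpace.basisFun (Fin 3) ℝ j) (y : E3) :
    ‖T y‖ ≤ 6 * ‖hCoeff e D y - (innerSL ℝ : E3 →L[ℝ] E3 →L[ℝ] ℝ)‖ := by
  set b := EuclideanSpace.basisFun (Fin 3) ℝ with hb
  set ε := ‖hCoeff e D y - (innerSL ℝ : E3 →L[ℝ] E3 →L[ℝ] ℝ)‖ with hε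
  have hb1 : ∀ i, ‖b i‖ = 1 := fun i ↦ b.orthonormal.1 i
  have hcomp : ∀ u v : Fin 3, |(hCoeff e D y - (innerSL ℝ : E3 →L[ℝ] E3 →L[ℝ] ℝ)) (b u) (b v)| ≤ ε := by
    intro u v
    have h := (hCoeff e D y - (innerSL ℝ : E3 →L[ℝ] E3 →L[ℝ] ℝ)).le_opNorm₂ (b u) (b v)
    rw [hb1, hb1, mul_one, mul_one, Real.norm_eq_abs] at h
    exact h
  rw [hT y]
  calc ‖∑ j, ((hCoeff e D y - (innerSL ℝ : E3 →L[ℝ] E3 →L[ℝ] ℝ)) (b k) (b j) -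
        (if j = k then ∑ l, (hCoeff e D y - (innerSL ℝ : E3 →L[ℝ] E3 →L[ℝ] ℝ)) (b l) (b l)
          else 0)) • b j‖
      ≤ ∑ j, ‖((hCoeff e D y - (innerSL ℝ : E3 →L[ℝ] E3 →L[ℝ] ℝ)) (b k) (b j) -
        (if j = k then ∑ l, (hCoeff e D y - (innerSL ℝ : E3 →L[ℝ] E3 →L[ℝ] ℝ)) (b l) (b l)
          else 0)) • b j‖ := norm_sum_le _ _
    _ ≤ ∑ j : Fin 3, (ε + if j = k then 3 * ε else 0) := by
        refine Finset.sum_le_sum fun j _ ↦ ?_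
        rw [norm_smul, hb1, mul_one, Real.norm_eq_abs]
        refine (abs_sub _ _).trans (add_le_add (hcomp k j) ?_)
        split_ifs
        · refine (Finset.abs_sum_le_sum_abs _ _).trans ?_
          calc ∑ l, |(hCoeff e D y - (innerSL ℝ : E3 →L[ℝ] E3 →L[ℝ] ℝ)) (b l) (b l)|
              ≤ ∑ _l : Fin 3, ε := Finset.sum_le_sum fun l _ ↦ hcomp l l
            _ = 3 * ε := by simp
        · simp
    _ = 6 * ε := by
        rw [Finset.sum_add_distrib, Finset.sum_ite_eq', if_pos (Finset.mem_univ _)]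
        simp
        ring

/-! ### Integrability on coordinate shells -/

omit [IsManifold (𝓡 3) ∞ X] in
/-- A function continuous on `{R < ‖y‖}` is integrable on every shell `{a < ‖y‖ < c}` with
`R < a` (it is continuous on the compact closed shell). [folklore] -/
theorem integrableOn_shell_of_continuousOn {F : Type*} [NormedAddCommGroup F] {f : E3 → F}
    {R a c : ℝ} (hf : ContinuousOn f {y : E3 | R < ‖y‖}) (hRa : R < a) :
    IntegrableOn f {y : E3 | a < ‖y‖ ∧ ‖y‖ < c} volume := by
  set Kc : Set E3 := {y : E3 | a ≤ ‖y‖} ∩ closedBall 0 c with hKc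
  have hK : IsCompact Kc :=
    (isCompact_closedBall (0 : E3) c).of_isClosed_subset
      ((isClosed_le continuous_const continuous_norm).inter isClosed_closedBall) inter_subset_right
  have hsub : {y : E3 | a < ‖y‖ ∧ ‖y‖ < c} ⊆ Kc := fun y hy ↦
    ⟨hy.1.le, mem_closedBall_zero_iff.2 hy.2.le⟩
  have hKR : Kc ⊆ {y : E3 | R < ‖y‖} := fun y hy ↦ by
    have : a ≤ ‖y‖ := hy.1
    show R < ‖y‖
    linarith
  exact ((hf.mono hKR).integrableOn_compact hK).mono_set hsub

/-- The scalar curvature read in the chart is continuous (indeed smooth) on `{R < ‖y‖}`.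
[folklore] -/
theorem continuousOn_scalarCurvatureCoeff [D.metric.HasLeviCivita] :
    ContinuousOn (scalarCurvatureCoeff e D) {y : E3 | e.R < ‖y‖} := by
  rw [scalarCurvatureCoeff_eq_endValue]
  exact (contDiffOn_endValue e D.metric.contMDiff_scalarCurvature).continuousOn

omit [IsManifold (𝓡 3) ∞ X] in
/-- `‖v‖ ≤ ∑ₖ |vₖ|` on `ℝ³`. [folklore] -/
theorem norm_le_sum_abs_coord (v : E3) : ‖v‖ ≤ ∑ k, |v k| := by
  set b := EuclideanSpace.basisFun (Fin 3) ℝ with hb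
  have hb1 : ∀ i, ‖b i‖ = 1 := fun i ↦ b.orthonormal.1 i
  have hcoord : ∀ k : Fin 3, ⟪b k, v⟫ = v k := fun k ↦ by
    rw [hb, EuclideanSpace.basisFun_apply, EuclideanSpace.inner_single_left, map_one, one_mul]
  calc ‖v‖ = ‖∑ k, ⟪b k, v⟫ • b k‖ := by rw [b.sum_repr' v]
    _ ≤ ∑ k, ‖⟪b k, v⟫ • b k‖ := norm_sum_le _ _
    _ = ∑ k, |v k| := Finset.sum_congr rfl fun k _ ↦ by
        rw [norm_smul, hb1, mul_one, Real.norm_eq_abs, hcoord]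

/-! ### Bounded truncated first moments of the scalar curvature -/
set_option maxHeartbeats 400000 in -- buildfix (bf3-g26): 160k/180k FAIL, 200k PASS at accept time; line-neutral budget line
/-- **The scalar curvature of an end with `h − δ = O₂(r⁻²)` has bounded truncated first
moments in the chart**: there are `C` and `R₂ > R` such that for all `R₂ ≤ a ≤ c` and
`k = 1, 2, 3`,

  `|∫_{a < ‖y‖ < c} R(h)(Φ y) yₖ dy| ≤ C`,

although `R(h)∘Φ` is only `O(r⁻⁴)` (so that `∫ |R(h)∘Φ| |y|` may diverge logarithmically). The
`r⁻⁴` part of the scalar curvature is in divergence form: with the ADM flux field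
`Vᵢ = ∑ⱼ (∂ⱼhᵢⱼ − ∂ᵢhⱼⱼ) = O(r⁻³)` one has `R(h)∘Φ = div V + Q`, `Q = O(r⁻⁶)` (Bartnik 1986,
(4.2)–(4.4); `exists_bound_scalarCurvatureCoeff_sub_trace`), and `Vₖ = div Tₖ` for the traceless
part `Tₖ = (h − δ)eₖ − tr(h − δ) eₖ`-type field `(Tₖ)ⱼ = (h − δ)ₖⱼ − δⱼₖ tr(h − δ) = O(r⁻²)`
(`trace_fderiv_tracelessPart`). Hence, by Gauss–Green on the shell
(`FluidPDE.setIntegral_shell_divergence_eq`) applied to `yₖ V` and to `Tₖ`,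
`∫ yₖ div V = ∮ yₖ ⟨ν, V⟩ − ∫ Vₖ = ∮ yₖ ⟨ν, V⟩ − ∮ ⟨ν, Tₖ⟩ = O(r · r⁻³ · r²) + O(r⁻² · r²) = O(1)`
at both radii, while `∫ |Q| |y| ≤ K ∫_{‖y‖>1} ‖y‖⁻⁵ < ∞`. This is the structural fact behind
the sharp `O(r⁻²)` remainder in Schoen–Yau's expansion `φ = 1 + A/r + ω` of the conformal factor
solving `Δφ = Rφ/8` (Comm. Math. Phys. 65 (1979), Lemma 3.3 with Lemma 3.2, (3.17)–(3.18)): it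
supplies the moment hypothesis of the far-field expansion
`Literature.Analysis.Potential.integral_inv_norm_sub_mul_sub_isBigO` for the source `R/8`.
[cite: SchoenYauPMT1979, Lemma 3.2–3.3, (3.17)–(3.18), (3.23)] -/
theorem exists_bound_setIntegral_scalarCurvatureCoeff_mul [D.metric.HasLeviCivita]
    (hAF : IsMetricAsymptoticallyFlat e D 2) :
    ∃ C R₂ : ℝ, e.R < R₂ ∧ ∀ (k : Fin 3) (a c : ℝ), R₂ ≤ a → a ≤ c →
      |∫ y in {y : E3 | a < ‖y‖ ∧ ‖y‖ < c}, scalarCurvatureCoeff e D y * y k| ≤ C := by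
  classical
  set b := EuclideanSpace.basisFun (Fin 3) ℝ with hb
  set δ : E3 →L[ℝ] E3 →L[ℝ] ℝ := innerSL ℝ with hδ
  have hb1 : ∀ i, ‖b i‖ = 1 := fun i ↦ b.orthonormal.1 i
  have hcoord : ∀ (w : E3) (k : Fin 3), w k = ⟪b k, w⟫ := fun w k ↦ by
    rw [hb, EuclideanSpace.basisFun_apply, EuclideanSpace.inner_single_left, map_one, one_mul]
  have habs_coord : ∀ (w : E3) (k : Fin 3), |w k| ≤ ‖w‖ := fun w k ↦ by
    have := PiLp.norm_apply_le w k
    rwa [Real.norm_eq_abs] at this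
  -- the ADM field, its extension and the linearisation error
  set V : E3 → E3 := fun x ↦ ∑ i, (∑ j, (partialH e D j i j x - partialH e D i j j x)) • b i
    with hVdef
  have hV : ∀ x, V x = ∑ i, (∑ j, (partialH e D j i j x - partialH e D i j j x)) • b i :=
    fun x ↦ rfl
  obtain ⟨W, hW, hWV⟩ := e.exists_contDiff_extension D V hV
  obtain ⟨K, R₁, hR₁, hR₁', hbound⟩ :=
    e.exists_bound_scalarCurvatureCoeff_sub_trace D V hV (by norm_num : (0 : ℝ) < 2) hAF
  have hWd : ∀ y, DifferentiableAt ℝ W y := fun y ↦ (hW.differentiable (by simp)) y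
  -- the traceless fields and their extensions
  set T : Fin 3 → E3 → E3 := fun k y ↦ ∑ j, ((hCoeff e D y - δ) (b k) (b j) -
      (if j = k then ∑ l, (hCoeff e D y - δ) (b l) (b l) else 0)) • b j with hTdef
  have hT : ∀ k y, T k y = ∑ j, ((hCoeff e D y - δ) (b k) (b j) -
      (if j = k then ∑ l, (hCoeff e D y - δ) (b l) (b l) else 0)) • b j := fun k y ↦ rfl
  have hTsmooth : ∀ (k) (x : E3), e.R < ‖x‖ → ContDiffAt ℝ 1 (T k) x := by
    intro k x hx
    have hG : ContDiffAt ℝ 1 (hCoeff e D) x :=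
      (e.contDiffAt_hCoeff D hx).of_le (WithTop.coe_le_coe.mpr le_top)
    have hc : ∀ u v : E3, ContDiffAt ℝ 1 (fun y ↦ (hCoeff e D y - δ) u v) x := by
      intro u v
      have : (fun y ↦ (hCoeff e D y - δ) u v) = fun y ↦ hCoeff e D y u v - δ u v := by
        funext y; simp only [_root_.sub_apply]
      rw [this]
      exact ((hG.clm_apply contDiffAt_const).clm_apply contDiffAt_const).sub contDiffAt_const
    refine ContDiffAt.sum fun j _ ↦ ContDiffAt.smul ((hc _ _).sub ?_) contDiffAt_const
    split_ifs
    · exact ContDiffAt.sum fun l _ ↦ hc _ _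
    · exact contDiffAt_const
  have hText : ∀ k, ∃ U : E3 → E3, ContDiff ℝ 1 U ∧ ∀ x, e.R + 2 ≤ ‖x‖ → U x = T k x :=
    fun k ↦ e.exists_contDiff_one_extension (hTsmooth k)
  choose U hU hUT using hText
  -- decay constants
  obtain ⟨c₀, hc₀, h0⟩ := (hAF 0 (by norm_num)).exists_pos
  obtain ⟨c₁, hc₁, h1⟩ := (hAF 1 (by norm_num)).exists_pos
  have hfd : ∀ y, fderiv ℝ (fun y ↦ hCoeff e D y - δ) y = fderiv ℝ (hCoeff e D) y :=
    fun y ↦ fderiv_sub_const _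
  have hev : ∀ᶠ x in cobounded E3, ‖hCoeff e D x - δ‖ ≤ c₀ * ‖x‖ ^ (-2 : ℝ) ∧
      ‖fderiv ℝ (hCoeff e D) x‖ ≤ c₁ * ‖x‖ ^ (-3 : ℝ) := by
    filter_upwards [h0.bound, h1.bound] with x hx0 hx1
    rw [norm_norm, norm_iteratedFDeriv_zero,
      Real.norm_of_nonneg (Real.rpow_nonneg (norm_nonneg _) _)] at hx0
    rw [norm_norm, norm_iteratedFDeriv_one, hfd,
      Real.norm_of_nonneg (Real.rpow_nonneg (norm_nonneg _) _)] at hx1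
    refine ⟨by simpa using hx0, ?_⟩
    rw [Nat.cast_one, show (-2 : ℝ) - 1 = -3 by norm_num] at hx1
    exact hx1
  obtain ⟨R₃, hR₃⟩ := exists_radius_of_eventually hev
  -- the radius
  set R₂ : ℝ := max (max (e.R + 3) R₁) (max R₃ 1) with hR₂
  have hR₂R : e.R + 2 < R₂ := by
    have h1 : e.R + 3 ≤ R₂ := (le_max_left _ _).trans (le_max_left _ _)
    linarith
  have hR₂1 : 1 ≤ R₂ := (le_max_right _ _).trans (le_max_right _ _)
  have hR₂R₁ : R₁ ≤ R₂ := (le_max_right _ _).trans (le_max_left _ _)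
  have hR₂R₃ : R₃ ≤ R₂ := (le_max_left _ _).trans (le_max_right _ _)
  have hR₂pos : 0 < R₂ := by linarith
  -- pointwise facts far out
  have hLV : ∀ x : E3, e.R + 2 < ‖x‖ →
      LinearMap.trace ℝ E3 (fderiv ℝ W x : E3 →ₗ[ℝ] E3) =
        LinearMap.trace ℝ E3 (fderiv ℝ V x : E3 →ₗ[ℝ] E3) := by
    intro x hx
    have heq : W =ᶠ[𝓝 x] V := by
      have hopen : IsOpen {y : E3 | e.R + 2 < ‖y‖} := isOpen_lt continuous_const continuous_norm
      filter_upwards [hopen.mem_nhds hx] with y hy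
      exact hWV y (le_of_lt hy)
    rw [heq.fderiv_eq]
  have hUTtr : ∀ (k) (x : E3), e.R + 2 < ‖x‖ →
      LinearMap.trace ℝ E3 (fderiv ℝ (U k) x : E3 →ₗ[ℝ] E3) = ⟪b k, W x⟫ := by
    intro k x hx
    have heq : U k =ᶠ[𝓝 x] T k := by
      have hopen : IsOpen {y : E3 | e.R + 2 < ‖y‖} := isOpen_lt continuous_const continuous_norm
      filter_upwards [hopen.mem_nhds hx] with y hy
      exact hUT k y (le_of_lt hy)
    rw [heq.fderiv_eq, e.trace_fderiv_tracelessPart D k (T k) (hT k) (by linarith),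
      hWV x hx.le, e.inner_admVec D V hV x k]
  -- sup bounds far out
  have hVbound : ∀ x : E3, R₂ ≤ ‖x‖ → ‖W x‖ ≤ 18 * c₁ * ‖x‖ ^ (-3 : ℝ) := by
    intro x hx
    rw [hWV x (by linarith)]
    refine (e.norm_admVec_le D V hV (by linarith)).trans ?_
    have := (hR₃ x (hR₂R₃.trans hx)).2
    nlinarith
  have hTbound : ∀ (k) (x : E3), R₂ ≤ ‖x‖ → ‖U k x‖ ≤ 6 * c₀ * ‖x‖ ^ (-2 : ℝ) := by
    intro k x hx
    rw [hUT k x (by linarith)]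
    refine (e.norm_tracelessPart_le D k (T k) (hT k) x).trans ?_
    have := (hR₃ x (hR₂R₃.trans hx)).1
    nlinarith
  -- the flux functions and their bounds
  set σu : ℝ := (volume : Measure E3).toSphere.real univ with hσu
  have hσu0 : 0 ≤ σu := measureReal_nonneg
  have hd : Module.finrank ℝ E3 - 1 = 2 := by simp
  set P : Fin 3 → E3 → E3 := fun k y ↦ y k • W y with hPdef
  have hP : ∀ k, ContDiff ℝ 1 (P k) := fun k ↦
    ((EuclideanSpace.proj (𝕜 := ℝ) k : E3 →L[ℝ] ℝ).contDiff).smul hW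
  set A : Fin 3 → ℝ → ℝ := fun k r ↦ r ^ (Module.finrank ℝ E3 - 1) *
    Analysis.FluidPDE.sphereIntegral (volume : Measure E3) (fun x ↦ ⟪‖x‖⁻¹ • x, P k x⟫) r
    with hA
  set B : Fin 3 → ℝ → ℝ := fun k r ↦ r ^ (Module.finrank ℝ E3 - 1) *
    Analysis.FluidPDE.sphereIntegral (volume : Measure E3) (fun x ↦ ⟪‖x‖⁻¹ • x, U k x⟫) r
    with hB
  have hAbound : ∀ (k) (r : ℝ), R₂ ≤ r → |A k r| ≤ 18 * c₁ * σu := by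
    intro k r hr
    have hr0 : 0 < r := by linarith
    have hpt : ∀ α : sphere (0 : E3) 1, ‖⟪‖r • (α : E3)‖⁻¹ • (r • (α : E3)), P k (r • (α : E3))⟫‖
        ≤ r * (18 * c₁ * r ^ (-3 : ℝ)) := by
      intro α
      set x : E3 := r • (α : E3) with hx
      have hxn : ‖x‖ = r := Analysis.FluidPDE.norm_smul_sphere hr0.le α
      rw [Real.norm_eq_abs]
      calc |⟪‖x‖⁻¹ • x, P k x⟫| ≤ ‖‖x‖⁻¹ • x‖ * ‖P k x‖ := abs_real_inner_le_norm _ _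
        _ ≤ 1 * (|x k| * ‖W x‖) := by
            have hPx : ‖P k x‖ = |x k| * ‖W x‖ := by
              rw [hPdef]
              simp only
              rw [norm_smul, Real.norm_eq_abs]
            rw [hPx]
            exact mul_le_mul_of_nonneg_right (norm_inv_norm_smul_le_one x) (by positivity)
        _ ≤ 1 * (r * (18 * c₁ * r ^ (-3 : ℝ))) := by
            gcongr
            · exact (habs_coord x k).trans hxn.le
            · rw [← hxn]; exact hVbound x (by rw [hxn]; exact hr)
        _ = r * (18 * c₁ * r ^ (-3 : ℝ)) := one_mul _
    have hint := norm_integral_le_of_norm_le_const (μ := (volume : Measure E3).toSphere)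
      (ae_of_all _ hpt)
    rw [hA]
    simp only
    rw [hd, abs_mul, abs_pow, abs_of_pos hr0, Analysis.FluidPDE.sphereIntegral_def]
    rw [Real.norm_eq_abs] at hint
    have hr3 : r ^ 2 * (r * (18 * c₁ * r ^ (-3 : ℝ))) = 18 * c₁ := by
      rw [Real.rpow_neg hr0.le, show (3 : ℝ) = (3 : ℕ) by norm_num, Real.rpow_natCast]
      field_simp
    calc r ^ 2 * |∫ α, ⟪‖r • (α : E3)‖⁻¹ • (r • (α : E3)), P k (r • (α : E3))⟫
          ∂(volume : Measure E3).toSphere|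
        ≤ r ^ 2 * (r * (18 * c₁ * r ^ (-3 : ℝ)) * σu) := by gcongr
      _ = 18 * c₁ * σu := by rw [← mul_assoc, hr3]
  have hBbound : ∀ (k) (r : ℝ), R₂ ≤ r → |B k r| ≤ 6 * c₀ * σu := by
    intro k r hr
    have hr0 : 0 < r := by linarith
    have hpt : ∀ α : sphere (0 : E3) 1, ‖⟪‖r • (α : E3)‖⁻¹ • (r • (α : E3)), U k (r • (α : E3))⟫‖
        ≤ 6 * c₀ * r ^ (-2 : ℝ) := by
      intro α
      set x : E3 := r • (α : E3) with hx
      have hxn : ‖x‖ = r := Analysis.FluidPDE.norm_smul_sphere hr0.le α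
      rw [Real.norm_eq_abs]
      calc |⟪‖x‖⁻¹ • x, U k x⟫| ≤ ‖‖x‖⁻¹ • x‖ * ‖U k x‖ := abs_real_inner_le_norm _ _
        _ ≤ 1 * (6 * c₀ * r ^ (-2 : ℝ)) := by
            refine mul_le_mul (norm_inv_norm_smul_le_one x) ?_ (norm_nonneg _) zero_le_one
            rw [← hxn]; exact hTbound k x (by rw [hxn]; exact hr)
        _ = 6 * c₀ * r ^ (-2 : ℝ) := one_mul _
    have hint := norm_integral_le_of_norm_le_const (μ := (volume : Measure E3).toSphere)
      (ae_of_all _ hpt)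
    rw [hB]
    simp only
    rw [hd, abs_mul, abs_pow, abs_of_pos hr0, Analysis.FluidPDE.sphereIntegral_def]
    rw [Real.norm_eq_abs] at hint
    have hr2 : r ^ 2 * (6 * c₀ * r ^ (-2 : ℝ)) = 6 * c₀ := by
      rw [Real.rpow_neg hr0.le, show (2 : ℝ) = (2 : ℕ) by norm_num, Real.rpow_natCast]
      field_simp
    calc r ^ 2 * |∫ α, ⟪‖r • (α : E3)‖⁻¹ • (r • (α : E3)), U k (r • (α : E3))⟫
          ∂(volume : Measure E3).toSphere|
        ≤ r ^ 2 * (6 * c₀ * r ^ (-2 : ℝ) * σu) := by gcongr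
      _ = 6 * c₀ * σu := by rw [← mul_assoc, hr2]
  -- the error integral
  set I₀ : ℝ := ∫ y in {y : E3 | 1 < ‖y‖}, K * ‖y‖ ^ (-(5 : ℝ)) with hI₀
  have hgint : IntegrableOn (fun y : E3 ↦ K * ‖y‖ ^ (-(5 : ℝ))) {y : E3 | 1 < ‖y‖} volume :=
    (integrableOn_rpow_neg_exterior (by norm_num) le_rfl).const_mul K
  have hK0 : 0 ≤ K := by
    -- from the bound at a point of norm `R₂`
    set z : E3 := R₂ • EuclideanSpace.single (0 : Fin 3) (1 : ℝ) with hz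
    have hzn : ‖z‖ = R₂ := by
      rw [hz, norm_smul, Real.norm_of_nonneg hR₂pos.le]; simp
    have h := hbound z (by rw [hzn]; exact hR₂R₁)
    have hpos : 0 < ‖z‖ ^ (-(2 * 2 + 2) : ℝ) := Real.rpow_pos_of_pos (by rw [hzn]; exact hR₂pos) _
    nlinarith [abs_nonneg (scalarCurvatureCoeff e D z -
      LinearMap.trace ℝ E3 (fderiv ℝ V z : E3 →ₗ[ℝ] E3))]
  -- the main estimate
  refine ⟨I₀ + 2 * (18 * c₁ * σu) + 2 * (6 * c₀ * σu), R₂, by linarith, fun k a c ha hac ↦ ?_⟩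
  have ha0 : 0 < a := by linarith
  set Sh : Set E3 := {y : E3 | a < ‖y‖ ∧ ‖y‖ < c} with hSh
  have hShm : MeasurableSet Sh :=
    (isOpen_lt continuous_const continuous_norm).measurableSet.inter
      (isOpen_lt continuous_norm continuous_const).measurableSet
  have hSh_far : ∀ y ∈ Sh, R₂ < ‖y‖ := fun y hy ↦ lt_of_le_of_lt ha hy.1
  have hint_of_cont : ∀ {f : E3 → ℝ}, ContinuousOn f {y : E3 | e.R < ‖y‖} →
      IntegrableOn f Sh volume := fun hf ↦ integrableOn_shell_of_continuousOn hf (by linarith)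
  -- the functions on the shell
  set S : E3 → ℝ := scalarCurvatureCoeff e D with hSdef
  set L : E3 → ℝ := fun y ↦ LinearMap.trace ℝ E3 (fderiv ℝ W y : E3 →ₗ[ℝ] E3) with hLdef
  have hSc : ContinuousOn S {y : E3 | e.R < ‖y‖} := e.continuousOn_scalarCurvatureCoeff D
  have hLc : Continuous L := Analysis.FluidPDE.continuous_trace_fderiv hW
  have hdivP : ∀ y, LinearMap.trace ℝ E3 (fderiv ℝ (P k) y : E3 →ₗ[ℝ] E3) = y k * L y + ⟪b k, W y⟫ := by
    intro y
    rw [hPdef, trace_fderiv_coord_smul (hWd y) k, hcoord (W y) k]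
  have hcoordc : Continuous fun y : E3 ↦ y k := (EuclideanSpace.proj (𝕜 := ℝ) k).continuous
  -- integrability on the shell
  have hiS : IntegrableOn (fun y ↦ S y * y k) Sh volume := hint_of_cont (hSc.mul hcoordc.continuousOn)
  have hiL : IntegrableOn (fun y ↦ y k * L y) Sh volume :=
    hint_of_cont ((hcoordc.mul hLc).continuousOn)
  have hiW : IntegrableOn (fun y ↦ ⟪b k, W y⟫) Sh volume :=
    hint_of_cont ((continuous_const.inner hW.continuous).continuousOn)
  have hSL : IntegrableOn (fun y ↦ (S y - L y) * y k) Sh volume :=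
    (hiS.sub hiL).congr (ae_of_all _ fun y ↦ by simp only [Pi.sub_apply]; ring)
  -- (1) the error term
  have hErr : |∫ y in Sh, (S y - L y) * y k| ≤ I₀ := by
    have hpt : ∀ y ∈ Sh, |(S y - L y) * y k| ≤ K * ‖y‖ ^ (-(5 : ℝ)) := by
      intro y hy
      have hyR₂ := hSh_far y hy
      have hy0 : 0 < ‖y‖ := by linarith
      have h1 := hbound y (by linarith)
      rw [← hLV y (by linarith)] at h1
      rw [abs_mul]
      calc |S y - L y| * |y k| ≤ K * ‖y‖ ^ (-(2 * 2 + 2) : ℝ) * ‖y‖ :=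
            mul_le_mul h1 (habs_coord y k) (abs_nonneg _)
              (mul_nonneg hK0 (Real.rpow_nonneg (norm_nonneg _) _))
        _ = K * ‖y‖ ^ (-(5 : ℝ)) := by
            rw [show (-(2 * 2 + 2) : ℝ) = -(5 : ℝ) + (-1) by norm_num, Real.rpow_add hy0,
              Real.rpow_neg_one]
            field_simp
    have hSh1 : Sh ⊆ {y : E3 | 1 < ‖y‖} := fun y hy ↦ by
      show 1 < ‖y‖
      linarith [hSh_far y hy]
    calc |∫ y in Sh, (S y - L y) * y k| ≤ ∫ y in Sh, |(S y - L y) * y k| := abs_integral_le_integral_abs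
      _ ≤ ∫ y in Sh, K * ‖y‖ ^ (-(5 : ℝ)) :=
          setIntegral_mono_on hSL.abs (hgint.mono_set hSh1) hShm hpt
      _ ≤ I₀ := setIntegral_mono_set hgint
          (ae_of_all _ fun y ↦ mul_nonneg hK0 (Real.rpow_nonneg (norm_nonneg _) _))
          (ae_of_all _ hSh1)
  -- (2) Gauss–Green for `yₖ W` and for `U k`
  have hGG1 : ∫ y in Sh, (y k * L y + ⟪b k, W y⟫) = A k c - A k a := by
    have h := Analysis.FluidPDE.setIntegral_shell_divergence_eq (volume : Measure E3) (hP k) ha0 hac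
    rw [hA]
    simp only
    rw [← h]
    exact setIntegral_congr_fun hShm fun y _ ↦ (hdivP y).symm
  have hGG2 : ∫ y in Sh, ⟪b k, W y⟫ = B k c - B k a := by
    have h := Analysis.FluidPDE.setIntegral_shell_divergence_eq (volume : Measure E3) (hU k) ha0 hac
    rw [hB]
    simp only
    rw [← h]
    exact setIntegral_congr_fun hShm fun y hy ↦ (hUTtr k y (by linarith [hSh_far y hy])).symm
  -- (3) assemble
  have hsplit : ∫ y in Sh, S y * y k =
      (∫ y in Sh, (S y - L y) * y k) + ((A k c - A k a) - (B k c - B k a)) := by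
    have e1 : (A k c - A k a) - (B k c - B k a) = ∫ y in Sh, y k * L y := by
      rw [← hGG1, ← hGG2, integral_add hiL hiW, add_sub_cancel_right]
    rw [e1, ← integral_add hSL hiL]
    refine integral_congr_ae (ae_of_all _ fun y ↦ ?_)
    simp only
    ring
  rw [hsplit]
  have hA1 := hAbound k a ha
  have hA2 := hAbound k c (ha.trans hac)
  have hB1 := hBbound k a ha
  have hB2 := hBbound k c (ha.trans hac)
  calc |(∫ y in Sh, (S y - L y) * y k) + ((A k c - A k a) - (B k c - B k a))|
      ≤ |∫ y in Sh, (S y - L y) * y k| + |(A k c - A k a) - (B k c - B k a)| := abs_add_le _ _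
    _ ≤ I₀ + (|A k c| + |A k a| + (|B k c| + |B k a|)) := by
        refine add_le_add hErr ((abs_sub _ _).trans (add_le_add (abs_sub _ _) (abs_sub _ _)))
    _ ≤ I₀ + 2 * (18 * c₁ * σu) + 2 * (6 * c₀ * σu) := by linarith

/-- **Vector form**: the truncated first moments `∫_{a<‖y‖<c} R(h)(Φ y) y dy ∈ ℝ³` are bounded,
uniformly in `R₂ ≤ a ≤ c`. [cite: SchoenYauPMT1979, Lemma 3.2–3.3, (3.17)–(3.18), (3.23)] -/
theorem exists_bound_norm_setIntegral_scalarCurvatureCoeff_smul [D.metric.HasLeviCivita]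
    (hAF : IsMetricAsymptoticallyFlat e D 2) :
    ∃ C R₂ : ℝ, e.R < R₂ ∧ ∀ a c : ℝ, R₂ ≤ a → a ≤ c →
      ‖∫ y in {y : E3 | a < ‖y‖ ∧ ‖y‖ < c}, scalarCurvatureCoeff e D y • y‖ ≤ C := by
  obtain ⟨C, R₂, hR₂, hC⟩ := e.exists_bound_setIntegral_scalarCurvatureCoeff_mul D hAF
  refine ⟨3 * C, R₂, hR₂, fun a c ha hac ↦ ?_⟩
  set Sh : Set E3 := {y : E3 | a < ‖y‖ ∧ ‖y‖ < c} with hSh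
  have hint : IntegrableOn (fun y ↦ scalarCurvatureCoeff e D y • y) Sh volume :=
    integrableOn_shell_of_continuousOn
      ((e.continuousOn_scalarCurvatureCoeff D).smul continuous_id.continuousOn) (by linarith)
  have hcomp : ∀ k : Fin 3, (∫ y in Sh, scalarCurvatureCoeff e D y • y) k =
      ∫ y in Sh, scalarCurvatureCoeff e D y * y k := by
    intro k
    have h := (EuclideanSpace.proj (𝕜 := ℝ) k : E3 →L[ℝ] ℝ).integral_comp_comm hint
    rw [show (∫ y in Sh, scalarCurvatureCoeff e D y • y) k =
      (EuclideanSpace.proj (𝕜 := ℝ) k : E3 →L[ℝ] ℝ) (∫ y in Sh, scalarCurvatureCoeff e D y • y)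
      from rfl, ← h]
    refine integral_congr_ae (ae_of_all _ fun y ↦ ?_)
    simp
  calc ‖∫ y in Sh, scalarCurvatureCoeff e D y • y‖
      ≤ ∑ k, |(∫ y in Sh, scalarCurvatureCoeff e D y • y) k| := norm_le_sum_abs_coord _
    _ ≤ ∑ _k : Fin 3, C := Finset.sum_le_sum fun k _ ↦ by rw [hcomp k]; exact hC k a c ha hac
    _ = 3 * C := by simp

/-- **Ball form** (the moment hypothesis of
`Literature.Analysis.Potential.integral_inv_norm_sub_mul_sub_isBigO` for the density
`𝟙_{R₂ < ‖y‖} R(h)∘Φ`): the moments `∫_{‖y‖<ρ} 𝟙_{R₂<‖y‖} R(h)(Φ y) y dy` are bounded uniformly in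
`ρ`. [cite: SchoenYauPMT1979, Lemma 3.2–3.3, (3.17)–(3.18), (3.23)] -/
theorem exists_bound_norm_setIntegral_ball_scalarCurvatureCoeff_smul [D.metric.HasLeviCivita]
    (hAF : IsMetricAsymptoticallyFlat e D 2) :
    ∃ C R₂ : ℝ, e.R < R₂ ∧ ∀ ρ : ℝ,
      ‖∫ y in ball (0 : E3) ρ, ({y : E3 | R₂ < ‖y‖}.indicator (scalarCurvatureCoeff e D) y) • y‖
        ≤ C := by
  obtain ⟨C, R₂, hR₂, hC⟩ := e.exists_bound_norm_setIntegral_scalarCurvatureCoeff_smul D hAF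
  have hC0 : 0 ≤ C := by
    have h := hC R₂ R₂ le_rfl le_rfl
    exact (norm_nonneg _).trans h
  refine ⟨C, R₂, hR₂, fun ρ ↦ ?_⟩
  have hmeas : MeasurableSet {y : E3 | R₂ < ‖y‖} :=
    (isOpen_lt continuous_const continuous_norm).measurableSet
  have hind : ∀ y : E3, ({y : E3 | R₂ < ‖y‖}.indicator (scalarCurvatureCoeff e D) y) • y =
      {y : E3 | R₂ < ‖y‖}.indicator (fun y ↦ scalarCurvatureCoeff e D y • y) y := fun y ↦ by
    by_cases hy : y ∈ {y : E3 | R₂ < ‖y‖}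
    · rw [indicator_of_mem hy, indicator_of_mem hy]
    · rw [indicator_of_notMem hy, indicator_of_notMem hy, zero_smul]
  simp_rw [hind]
  rw [setIntegral_indicator hmeas]
  have hset : ball (0 : E3) ρ ∩ {y : E3 | R₂ < ‖y‖} = {y : E3 | R₂ < ‖y‖ ∧ ‖y‖ < ρ} := by
    ext y
    simp only [mem_inter_iff, mem_ball_zero_iff, mem_setOf_eq]
    tauto
  rw [hset]
  by_cases hρ : R₂ ≤ ρ
  · exact hC R₂ ρ le_rfl hρ
  · have hempty : {y : E3 | R₂ < ‖y‖ ∧ ‖y‖ < ρ} = ∅ := by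
      ext y
      simp only [mem_setOf_eq, mem_empty_iff_false, iff_false, not_and, not_lt]
      intro hy
      linarith
    rw [hempty, Measure.restrict_empty, integral_zero_measure, norm_zero]
    exact hC0

end AFEnd

end Literature.Geometry.Lorentzian
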